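import Summits.QuantumAdvantage.QuantumAdvantage.Theorems.CharDialMultiBlockMoebius
import Summits.QuantumAdvantage.QuantumAdvantage.Theorems.CharDialFrobSpace
import HarnessLib

/-!
# MultiBlockFrob — the Frobenius structure law on the m-BLOCK-SYMMETRIC class (all `m`, all `n`, all `p`)

(decomp-qadv-lens-6 g8.)  `SubChar.mBlock_frob`: if a Boolean `f` of `𝔽_p`-degree `≤ p − 1` depends only on the
weights inside a disjoint family of blocks `A_0, …, A_{m−1}` (each of size `≥ p − 1`), then
`f(u) = h(Σ_j a_j · wt_{A_j}(u) mod p)` — ONE linear form, constant on blocks; `mBlock_frob_law` restates it in the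
CharDial node's `FrobStructureLaw` shape (`J = ∅`, one coefficient vector).  `m = 1` is `symmetric_frob`, `m = 2` is
`twoBlock_frob`; the engine for general `m` is `FrobPlane.frobSpace` (all-k plane sector) in place of `frobPlane`.
Chain: `moeb_mBlock` ⇒ interpolating polynomial `Σ_{|i| ≤ p−1} γ(i) Π_j C(X_j, i_j)` of total degree `≤ p − 1`
(coefficients with `|i| ≥ p` vanish by `moeb_eq_zero_of_mem_lowDeg`) ⇒ `frobSpace` ⇒ `block_periodic` per block.
-/

namespace Summit.QuantumAdvantage.AdviceFreeQNC0

namespace SubChar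

open Finset MvPolynomial
open Literature.Computability.MetaComplexity Literature.Computability.MetaComplexity.Smolensky
open SubLog FrobPlane

variable {n m : ℕ}

/-- **The Frobenius structure law on the m-block-symmetric class.** -/
theorem mBlock_frob (p : ℕ) [hp : Fact p.Prime] (A : Fin m → Finset (Fin n))
    (hdis : ∀ j k, j ≠ k → Disjoint (A j) (A k)) (hA : ∀ j, p - 1 ≤ (A j).card) (f : (Fin n → Bool) → Bool)
    (hsym : ∀ u v : Fin n → Bool, (∀ j, bw (A j) u = bw (A j) v) → f u = f v)
    (hf : HasDegF p f (p - 1)) :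
    ∃ (a : Fin m → ZMod p) (h : ZMod p → Bool), ∀ u,
      f u = h (∑ j, a j * ∑ i ∈ A j, (if u i then (1 : ZMod p) else 0)) := by
  classical
  have hp1 : 1 < p := hp.out.one_lt
  -- the profile of f
  let wv : (Fin n → Bool) → (Fin m → ℕ) := fun u j => bw (A j) u
  let Φ : (Fin m → ℕ) → Bool := fun w =>
    if h : ∃ u : Fin n → Bool, wv u = w then f (Classical.choose h) else false
  have hΦ : ∀ u, f u = Φ (wv u) := by
    intro u
    have h : ∃ v : Fin n → Bool, wv v = wv u := ⟨u, rfl⟩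
    simp only [Φ, dif_pos h]
    have hc := Classical.choose_spec h
    exact hsym u _ fun j => (congrFun hc j).symm
  -- realizing sets
  have hreal : ∀ w : Fin m → ℕ, (∀ j, w j ≤ (A j).card) →
      ∃ T ⊆ blockUnion A, ∀ j, (T ∩ A j).card = w j := fun w hw => exists_realize hdis w hw
  -- the indicator and its Möbius coefficients
  let g : (Fin n → Bool) → ZMod p := indR (ZMod p) f
  have hg_mem : g ∈ lowDeg (ZMod p) n (p - 1) := (hasDegF_iff_indR p f (p - 1)).1 hf
  let Φh : (Fin m → ℕ) → ZMod p := fun w => if Φ w = true then 1 else 0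
  have hwv_vert : ∀ T, wv (vert T) = fun j => (T ∩ A j).card := by
    intro T; funext j; exact bw_vert (A j) T
  have hgvert : ∀ T ⊆ blockUnion A, g (vert T) = Φh (fun j => (T ∩ A j).card) := by
    intro T _
    simp only [g, indR, Φh, hΦ (vert T), hwv_vert]
  have hmoeb : ∀ S ⊆ blockUnion A, moeb g S = gamM Φh (fun j => (S ∩ A j).card) :=
    fun S hS => moeb_mBlock hdis g Φh hgvert hS
  -- γ(i) = 0 when Σ i_j ≥ p (degree test)
  have hgam0 : ∀ i : Fin m → ℕ, (∀ j, i j < p) → p ≤ ∑ j, i j → gamM Φh i = 0 := by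
    intro i hi hsum
    obtain ⟨S, hS, hSA⟩ := hreal i fun j => by have := hA j; have := hi j; omega
    have hi' : (fun j => (S ∩ A j).card) = i := funext hSA
    rw [← hi', ← hmoeb S hS]
    refine moeb_eq_zero_of_mem_lowDeg hg_mem ?_
    rw [card_eq_mBlock hdis hS]
    have : ∑ j, (S ∩ A j).card = ∑ j, i j := Finset.sum_congr rfl fun j _ => hSA j
    rw [this]; omega
  -- the interpolating polynomial
  let box : Finset (Fin m → ℕ) := Fintype.piFinset fun _ => range p
  let idx : Finset (Fin m → ℕ) := box.filter fun i => ∑ j, i j ≤ p - 1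
  let P : MvPolynomial (Fin m) (ZMod p) :=
    ∑ i ∈ idx, MvPolynomial.C (gamM Φh i) * ∏ j, binomPm j (i j)
  have hdeg : P.totalDegree ≤ p - 1 := by
    refine (totalDegree_finsetSum _ _).trans (Finset.sup_le fun i hi => ?_)
    have hi' := (mem_filter.1 hi).2
    refine (totalDegree_mul _ _).trans ?_
    rw [totalDegree_C, zero_add]
    refine (totalDegree_finsetProd _ _).trans ?_
    exact (Finset.sum_le_sum fun j _ => totalDegree_binomPm j (i j)).trans hi'
  -- evaluation of P
  have hevalP : ∀ x : Fin m → ZMod p, MvPolynomial.eval x P =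
      ∑ i ∈ box, (∏ j, (((x j).val.choose (i j) : ℕ) : ZMod p)) * gamM Φh i := by
    intro x
    simp only [P, MvPolynomial.eval_sum, MvPolynomial.eval_mul, MvPolynomial.eval_C, MvPolynomial.eval_prod]
    rw [Finset.sum_filter]
    refine Finset.sum_congr rfl fun i hi => ?_
    have hi' : ∀ j, i j < p := fun j => mem_range.1 (Fintype.mem_piFinset.1 hi j)
    by_cases hq : ∑ j, i j ≤ p - 1
    · rw [if_pos hq, mul_comm]
      congr 1
      exact Finset.prod_congr rfl fun j _ => eval_binomPm x j (hi' j)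
    · rw [if_neg hq, hgam0 i hi' (by omega), mul_zero]
  -- the profile at small weights, via Möbius inversion
  have hprof : ∀ w : Fin m → ℕ, (∀ j, w j < p) →
      (if Φ w = true then (1 : ZMod p) else 0) =
        ∑ i ∈ box, (∏ j, ((( w j).choose (i j) : ℕ) : ZMod p)) * gamM Φh i := by
    intro w hw
    obtain ⟨T, hT, hTA⟩ := hreal w fun j => by have := hA j; have := hw j; omega
    have hw' : (fun j => (T ∩ A j).card) = w := funext hTA
    have h1 : (if Φ w = true then (1 : ZMod p) else 0) = g (vert T) := by
      rw [hgvert T hT, hw']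
    rw [h1, ← sum_moeb_powerset g T]
    have h2 : ∑ S ∈ T.powerset, moeb g S = ∑ S ∈ T.powerset, gamM Φh (fun j => (S ∩ A j).card) :=
      Finset.sum_congr rfl fun S hS => hmoeb S ((mem_powerset.1 hS).trans hT)
    rw [h2, sum_powerset_mBlock hdis hT (gamM Φh)]
    simp only [hTA]
    -- extend the box from Π range (w j + 1) to Π range p
    have hsub : Fintype.piFinset (fun j => range (w j + 1)) ⊆ box :=
      Fintype.piFinset_subset _ _ fun j => range_subset_range.2 (by have := hw j; omega)
    rw [← Finset.sum_subset hsub]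
    · refine Finset.sum_congr rfl fun i _ => ?_
      rw [nsmul_eq_mul, Nat.cast_prod]
    · intro i _ hi
      rw [Fintype.mem_piFinset, not_forall] at hi
      obtain ⟨j, hj⟩ := hi
      rw [mem_range, not_lt] at hj
      have : (((w j).choose (i j) : ℕ) : ZMod p) = 0 := by
        rw [Nat.choose_eq_zero_of_lt (by omega), Nat.cast_zero]
      rw [Finset.prod_eq_zero (Finset.mem_univ j) this, zero_mul]
  -- Boolean profile on 𝔽_p^m and frobSpace
  let G : (Fin m → ZMod p) → Bool := fun x => Φ (fun j => (x j).val)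
  have hP : ∀ x, MvPolynomial.eval x P = if G x then 1 else 0 := by
    intro x
    rw [hevalP x]
    exact (hprof (fun j => (x j).val) fun j => ZMod.val_lt _).symm
  obtain ⟨β, h, hGh⟩ := frobSpace p m G P hdeg hP
  -- periodicity of the profile in each block weight
  have hper : ∀ (j : Fin m) (w w' : Fin m → ℕ), (∀ k, w k ≤ (A k).card) → (∀ k, k ≠ j → w' k = w k) →
      w' j = w j + p → w' j ≤ (A j).card → Φ w' = Φ w := by
    intro j w w' hw hw'k hw'j hw'A
    obtain ⟨T, hT, hTA⟩ := hreal w hw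
    let u : Fin n → Bool := vert T
    have hu : ∀ k, bw (A k) u = w k := fun k => by rw [bw_vert, hTA]
    have hZ : p ≤ ((A j).filter fun k => u k = false).card := by
      have h1 : ((A j).filter fun k => u k = false) = A j \ ((A j).filter fun k => u k = true) := by
        ext k; by_cases hk : k ∈ A j <;> simp [hk]
      rw [h1, card_sdiff_of_subset (filter_subset _ _)]
      have : ((A j).filter fun k => u k = true).card = w j := hu j
      omega
    obtain ⟨Y, hYsub, hYcard⟩ := Finset.exists_subset_card_eq hZ
    have hYA : Y ⊆ A j := hYsub.trans (filter_subset _ _)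
    have hY0 : ∀ k ∈ Y, u k = false := fun k hk => (mem_filter.1 (hYsub hk)).2
    have hwY : ∀ T' ⊆ Y, ∀ k, bw (A k) (setOn T' u) = if k = j then w j + T'.card else w k := by
      intro T' hT' k
      rw [bw_setOn (fun i hi => hY0 i (hT' hi)), hu k]
      by_cases hk : k = j
      · subst hk
        rw [if_pos rfl, inter_eq_left.2 (hT'.trans hYA)]
      · have : T' ∩ A k = ∅ :=
          disjoint_iff_inter_eq_empty.1 ((hdis j k (Ne.symm hk)).mono_left (hT'.trans hYA))
        rw [if_neg hk, this, card_empty, add_zero]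
    have hblock := block_periodic p (d := p - 1) (by omega) hf u Y hYcard hY0
      (fun T₁ hT₁ T₂ hT₂ hc => hsym _ _ fun k => by rw [hwY T₁ hT₁, hwY T₂ hT₂, hc])
    have e1 : f (setOn Y u) = Φ w' := by
      rw [hΦ]
      congr 1
      funext k
      show bw (A k) (setOn Y u) = w' k
      rw [hwY Y (Subset.refl _)]
      by_cases hk : k = j
      · subst hk; rw [if_pos rfl, hYcard, hw'j]
      · rw [if_neg hk, hw'k k hk]
    have e2 : f u = Φ w := by
      rw [hΦ]
      congr 1
      funext k
      exact hu k
    rw [← e1, ← e2, hblock]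
  -- reduction of one coordinate mod p
  have hmod1 : ∀ (j : Fin m) (N : ℕ) (w : Fin m → ℕ), w j ≤ N → (∀ k, w k ≤ (A k).card) →
      Φ w = Φ (fun k => if k = j then w k % p else w k) := by
    intro j N
    induction N using Nat.strong_induction_on with
    | _ N ih =>
      intro w hwN hw
      by_cases hlt : w j < p
      · congr 1
        funext k
        by_cases hk : k = j
        · subst hk; rw [if_pos rfl, Nat.mod_eq_of_lt hlt]
        · rw [if_neg hk]
      · have hpj : p ≤ w j := Nat.le_of_not_lt hlt
        let w' : Fin m → ℕ := fun k => if k = j then w j - p else w k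
        have hw'k : ∀ k, k ≠ j → w k = w' k := fun k hk => by simp [w', hk]
        have hw'j : w j = w' j + p := by simp [w']; omega
        have hw' : ∀ k, w' k ≤ (A k).card := by
          intro k
          by_cases hk : k = j
          · subst hk; simp [w']; have := hw k; omega
          · simp [w', hk]; exact hw k
        have h1 : Φ w = Φ w' := hper j w' w hw' hw'k hw'j (hw j)
        rw [h1, ih (w j - p) (by omega) w' (by simp [w']) hw']
        congr 1
        funext k
        by_cases hk : k = j
        · subst hk; simp [w', Nat.mod_eq_sub_mod hpj]
        · simp [w', hk]
  have hmod : ∀ w : Fin m → ℕ, (∀ k, w k ≤ (A k).card) → Φ w = Φ (fun k => w k % p) := by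
    have key : ∀ (s : Finset (Fin m)) (w : Fin m → ℕ), (∀ k, w k ≤ (A k).card) →
        Φ w = Φ (fun k => if k ∈ s then w k % p else w k) := by
      intro s
      induction s using Finset.induction_on with
      | empty => intro w _; simp
      | insert j s hjs ih =>
        intro w hw
        let v : Fin m → ℕ := fun k => if k ∈ s then w k % p else w k
        have hv : ∀ k, v k ≤ (A k).card := by
          intro k
          by_cases hk : k ∈ s
          · simp [v, hk]; exact (Nat.mod_le _ _).trans (hw k)
          · simp [v, hk]; exact hw k
        rw [ih w hw, hmod1 j (v j) v le_rfl hv]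
        congr 1
        funext k
        by_cases hkj : k = j
        · subst hkj
          by_cases hks : k ∈ s
          · simp [v, hks]
          · simp [v, hks]
        · by_cases hks : k ∈ s
          · simp [v, hkj, hks]
          · simp [v, hkj, hks]
    intro w hw
    rw [key Finset.univ w hw]
    simp
  -- assemble
  refine ⟨β, h, fun u => ?_⟩
  let x₀ : Fin m → ZMod p := fun j => (bw (A j) u : ZMod p)
  have hx : G x₀ = f u := by
    show Φ (fun j => (x₀ j).val) = f u
    rw [hΦ u, hmod _ fun k => bw_le (A k) u]
    congr 1
    funext j
    simp [x₀, ZMod.val_natCast]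
  have h2 : f u = h (∑ j, β j * x₀ j) := hx.symm.trans (hGh x₀)
  rw [h2]
  simp [x₀, natCast_bw]

/-- The same in the CharDial node's `FrobStructureLaw` shape: ONE coefficient vector (constant on each block, zero
off the blocks) and `J = ∅`. -/
theorem mBlock_frob_law (p : ℕ) [hp : Fact p.Prime] (A : Fin m → Finset (Fin n))
    (hdis : ∀ j k, j ≠ k → Disjoint (A j) (A k)) (hA : ∀ j, p - 1 ≤ (A j).card) (f : (Fin n → Bool) → Bool)
    (hsym : ∀ u v : Fin n → Bool, (∀ j, bw (A j) u = bw (A j) v) → f u = f v)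
    (hf : HasDegF p f (p - 1)) :
    ∃ (c : Fin n → ZMod p) (h : ZMod p → Bool), ∀ u, f u = h (∑ i, if u i then c i else 0) := by
  classical
  obtain ⟨a, h, hh⟩ := mBlock_frob p A hdis hA f hsym hf
  refine ⟨fun i => ∑ j, if i ∈ A j then a j else 0, h, fun u => ?_⟩
  rw [hh u]
  congr 1
  have h1 : ∀ j, a j * (∑ i ∈ A j, if u i then (1 : ZMod p) else 0)
      = ∑ i, if u i then (if i ∈ A j then a j else 0) else 0 := by
    intro j
    rw [Finset.mul_sum]
    have : (∑ i ∈ A j, a j * (if u i then (1 : ZMod p) else 0))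
        = ∑ i, if i ∈ A j then a j * (if u i then (1 : ZMod p) else 0) else 0 := by
      rw [Finset.sum_ite_mem, Finset.univ_inter]
    rw [this]
    refine Finset.sum_congr rfl fun i _ => ?_
    by_cases hi : i ∈ A j <;> by_cases hu : u i <;> simp [hi, hu]
  rw [Finset.sum_congr rfl fun j _ => h1 j, Finset.sum_comm]
  refine Finset.sum_congr rfl fun i _ => ?_
  by_cases hu : u i
  · simp [hu]
  · simp [hu]

end SubChar

end Summit.QuantumAdvantage.AdviceFreeQNC0
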